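import Summits.SmoothPoincare4.SmoothPoincare4.Theorems.SblfDescentRungOneDefs
import Literature.Topology.FourManifolds.KnotFraming
import Mathlib.Analysis.Complex.Isometry
import HarnessLib

/-!
# Base geometry of the torus-side product chart

Helper layer `helper_degree_base` of the brick `helper_sliceGluing_vanishingDegree` (apex leaf
F0, the degree lemma) of line `Sketch`, crux `SblfDescent.RungOne`
(crux item stmt-SmoothPoincare4-18531).

For the torus side presented as a product `ιT : Fb × ℝ² → X` (`IsTorusSideProduct f v ιT`:
`f (ιT (θ, w)) = σ₋ᵥ⁻¹ (univBall 0 2 w)` with `σ₋ᵥ = stereographic' 2 (-v)` and the pole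
`v = (0, 0, ±1)`) we compute the base point `f (ιT (θ, w))` explicitly:

* its height is `⟪f, v⟫ = v₂ · f₂ = 1 / (1 + 2‖w‖²)` (`helper_degree_base_level`);
* its planar part is `(f₀, f₁) = (2 √(1 + ‖w‖²) / (1 + 2‖w‖²)) · O w` for a fixed linear
  isometry `O` of `ℝ²` — the arbitrary orthonormal basis hidden in Mathlib's `stereographic'`
  (`helper_degree_base_planar`);
* a linear isometry of `ℝ²` is a rotation or a reflection: `O (circlePt t) = circlePt (s₀ t + α)`
  with `s₀ = ±1` (`helper_degree_isometry_circlePt`, from Mathlib's `linear_isometry_complex`);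
* packaged for the degree lemma (`helper_degree_base`): along the base circle
  `t ↦ ιT (θ, R · circlePt t)` the height is the constant `1 / (1 + 2R²)` and the longitude is
  `circlePt (s₀ t + α)`, so the longitude loop has degree `s₀ = ±1`.

## References

* R. İ. Baykur, S. Kamada, *Classification of broken Lefschetz fibrations with small fiber
  genera*, J. Math. Soc. Japan 67 (2015), §2. [BaykurKamada2015]
-/

set_option linter.dupNamespace false

noncomputable section

open scoped Manifold ContDiff Topology RealInnerProductSpace
open Set Function Literature.Topology.FourManifolds

namespace Summit.SmoothPoincare4.SmoothPoincare4.Cruxes.RungOne.Sketch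

attribute [local instance] Literature.Topology.FourManifolds.fact_finrank_euclideanSpace_succ

/-- Mathlib's radial map `univBall 0 2 : ℝ² → B(0, 2)` is `w ↦ (2 / √(1 + ‖w‖²)) • w`.
[folklore] -/
theorem helper_degree_univBall_two_apply (w : EuclideanSpace ℝ (Fin 2)) :
    OpenPartialHomeomorph.univBall (0 : EuclideanSpace ℝ (Fin 2)) 2 w =
      ((2 : ℝ) * (√(1 + ‖w‖ ^ 2))⁻¹) • w := by
  rw [OpenPartialHomeomorph.univBall, dif_pos two_pos, OpenPartialHomeomorph.trans'_apply,
    OpenPartialHomeomorph.unitBallBall_apply, OpenPartialHomeomorph.univUnitBall_apply, smul_smul,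
    vadd_eq_add, add_zero]

/-- The squared norm of `univBall 0 2 w` is `4‖w‖² / (1 + ‖w‖²)`. [folklore] -/
theorem helper_degree_norm_univBall_two_sq (w : EuclideanSpace ℝ (Fin 2)) :
    ‖OpenPartialHomeomorph.univBall (0 : EuclideanSpace ℝ (Fin 2)) 2 w‖ ^ 2 =
      4 * ‖w‖ ^ 2 / (1 + ‖w‖ ^ 2) := by
  have h1 : 0 < 1 + ‖w‖ ^ 2 := by positivity
  rw [helper_degree_univBall_two_apply, norm_smul, mul_pow, Real.norm_eq_abs, abs_mul, abs_inv,
    abs_of_pos two_pos, abs_of_nonneg (Real.sqrt_nonneg _), mul_pow, inv_pow, Real.sq_sqrt h1.le]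
  field_simp
  ring

section Pole

variable (v : Metric.sphere (0 : EuclideanSpace ℝ (Fin 3)) 1)

/-- A vector orthogonal to the pole `-v`, `v = (0, 0, v₂)`, has vanishing third coordinate.
[folklore] -/
theorem helper_degree_orth_apply_two (hv0 : (v : EuclideanSpace ℝ (Fin 3)) 0 = 0)
    (hv1 : (v : EuclideanSpace ℝ (Fin 3)) 1 = 0)
    (W : (ℝ ∙ (((-v : Metric.sphere (0 : EuclideanSpace ℝ (Fin 3)) 1) :
      Metric.sphere (0 : EuclideanSpace ℝ (Fin 3)) 1) : EuclideanSpace ℝ (Fin 3)))ᗮ) :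
    (W : EuclideanSpace ℝ (Fin 3)) 2 = 0 := by
  have hW := W.2
  rw [Submodule.mem_orthogonal_singleton_iff_inner_right] at hW
  have hv2 : (v : EuclideanSpace ℝ (Fin 3)) 2 ^ 2 = 1 := by
    have hn := norm_eq_of_mem_sphere v
    have : ‖(v : EuclideanSpace ℝ (Fin 3))‖ ^ 2 = 1 := by rw [hn]; norm_num
    rw [EuclideanSpace.norm_eq, Real.sq_sqrt (Finset.sum_nonneg fun i _ => by positivity),
      Fin.sum_univ_three] at this
    simpa [hv0, hv1] using this
  have hinner : ∀ Z : EuclideanSpace ℝ (Fin 3),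
      ⟪((-v : Metric.sphere (0 : EuclideanSpace ℝ (Fin 3)) 1) : EuclideanSpace ℝ (Fin 3)), Z⟫ =
        -((v : EuclideanSpace ℝ (Fin 3)) 2 * Z 2) := fun Z => by
    rw [coe_neg_sphere, inner_neg_left, EuclideanSpace.inner_eq_star_dotProduct]
    simp [dotProduct, Fin.sum_univ_three, hv0, hv1, mul_comm]
  rw [hinner] at hW
  have hv2ne : (v : EuclideanSpace ℝ (Fin 3)) 2 ≠ 0 := by
    intro h; rw [h] at hv2; norm_num at hv2
  have := neg_eq_zero.1 hW
  exact (mul_eq_zero.1 this).resolve_left hv2ne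

end Pole

section Side

variable {X : Type} [TopologicalSpace X] [ChartedSpace (EuclideanSpace ℝ (Fin 4)) X]
  {Fb : Type} [TopologicalSpace Fb] [ChartedSpace (EuclideanSpace ℝ (Fin 2)) Fb]
  {f : X → Metric.sphere (0 : EuclideanSpace ℝ (Fin 3)) 1}
  {v : Metric.sphere (0 : EuclideanSpace ℝ (Fin 3)) 1}
  {ιT : Fb × EuclideanSpace ℝ (Fin 2) → X}

/-- **The stereographic inverse at the pole `-v`, in coordinates**: for `v = (0, 0, v₂)` there is
a linear isometry `O` of `ℝ²` (the planar part of the orthonormal-basis isomorphism hidden in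
Mathlib's `stereographic'`) such that `σ₋ᵥ⁻¹ x` has coordinates
`((‖x‖² + 4)⁻¹ · 4 · (O x)₀, (‖x‖² + 4)⁻¹ · 4 · (O x)₁, (‖x‖² + 4)⁻¹ · (4 - ‖x‖²) · v₂)`.
[folklore] -/
theorem helper_degree_stereo_symm_coord (hv0 : (v : EuclideanSpace ℝ (Fin 3)) 0 = 0)
    (hv1 : (v : EuclideanSpace ℝ (Fin 3)) 1 = 0) :
    ∃ O : EuclideanSpace ℝ (Fin 2) →ₗᵢ[ℝ] EuclideanSpace ℝ (Fin 2), ∀ x : EuclideanSpace ℝ (Fin 2),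
    (((stereographic' 2 (-v)).symm x : Metric.sphere (0 : EuclideanSpace ℝ (Fin 3)) 1) :
        EuclideanSpace ℝ (Fin 3)) 0 = (‖x‖ ^ 2 + 4)⁻¹ * 4 * (O x) 0 ∧
    (((stereographic' 2 (-v)).symm x : Metric.sphere (0 : EuclideanSpace ℝ (Fin 3)) 1) :
        EuclideanSpace ℝ (Fin 3)) 1 = (‖x‖ ^ 2 + 4)⁻¹ * 4 * (O x) 1 ∧
    (((stereographic' 2 (-v)).symm x : Metric.sphere (0 : EuclideanSpace ℝ (Fin 3)) 1) :
        EuclideanSpace ℝ (Fin 3)) 2 = (‖x‖ ^ 2 + 4)⁻¹ * (4 - ‖x‖ ^ 2) * (v : EuclideanSpace ℝ (Fin 3)) 2 := by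
  set U : (ℝ ∙ (((-v : Metric.sphere (0 : EuclideanSpace ℝ (Fin 3)) 1) :
        Metric.sphere (0 : EuclideanSpace ℝ (Fin 3)) 1) : EuclideanSpace ℝ (Fin 3)))ᗮ ≃ₗᵢ[ℝ]
        EuclideanSpace ℝ (Fin 2) :=
      (OrthonormalBasis.fromOrthogonalSpanSingleton 2 (ne_zero_of_mem_unit_sphere
        (-v : Metric.sphere (0 : EuclideanSpace ℝ (Fin 3)) 1))).repr with hU
  -- the planar projection `z ↦ (z₀, z₁)` and the planar part of `U⁻¹`
  let P : EuclideanSpace ℝ (Fin 3) →ₗ[ℝ] EuclideanSpace ℝ (Fin 2) :=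
    { toFun := fun z => WithLp.toLp 2 ![z 0, z 1]
      map_add' := fun z z' => by ext i; fin_cases i <;> simp
      map_smul' := fun c z => by ext i; fin_cases i <;> simp }
  have hP0 : ∀ z, P z 0 = z 0 := fun z => rfl
  have hP1 : ∀ z, P z 1 = z 1 := fun z => rfl
  set L : EuclideanSpace ℝ (Fin 2) →ₗ[ℝ] EuclideanSpace ℝ (Fin 2) :=
    P ∘ₗ (Submodule.subtype _) ∘ₗ U.symm.toLinearEquiv.toLinearMap with hL
  have hL0 : ∀ x, L x 0 = (U.symm x : EuclideanSpace ℝ (Fin 3)) 0 := fun x => rfl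
  have hL1 : ∀ x, L x 1 = (U.symm x : EuclideanSpace ℝ (Fin 3)) 1 := fun x => rfl
  have hW2 : ∀ x, (U.symm x : EuclideanSpace ℝ (Fin 3)) 2 = 0 := fun x =>
    helper_degree_orth_apply_two v hv0 hv1 _
  have hnormW : ∀ x, ‖(U.symm x : EuclideanSpace ℝ (Fin 3))‖ = ‖x‖ := fun x => by
    rw [← U.symm.norm_map x]; rfl
  have hnormL : ∀ x, ‖L x‖ = ‖x‖ := fun x => by
    rw [← hnormW x, EuclideanSpace.norm_eq, EuclideanSpace.norm_eq, Fin.sum_univ_two,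
      Fin.sum_univ_three, hL0, hL1, hW2]
    simp
  refine ⟨{ toLinearMap := L, norm_map' := hnormL }, fun x => ?_⟩
  have h := stereographic'_symm_apply (n := 2) (-v) x
  simp only at h
  rw [← hU] at h
  have hneg0 : (((-v : Metric.sphere (0 : EuclideanSpace ℝ (Fin 3)) 1) :
      Metric.sphere (0 : EuclideanSpace ℝ (Fin 3)) 1) : EuclideanSpace ℝ (Fin 3)) 0 = 0 := by
    rw [coe_neg_sphere]; simp [hv0]
  have hneg1 : (((-v : Metric.sphere (0 : EuclideanSpace ℝ (Fin 3)) 1) :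
      Metric.sphere (0 : EuclideanSpace ℝ (Fin 3)) 1) : EuclideanSpace ℝ (Fin 3)) 1 = 0 := by
    rw [coe_neg_sphere]; simp [hv1]
  have hneg2 : (((-v : Metric.sphere (0 : EuclideanSpace ℝ (Fin 3)) 1) :
      Metric.sphere (0 : EuclideanSpace ℝ (Fin 3)) 1) : EuclideanSpace ℝ (Fin 3)) 2 =
      -(v : EuclideanSpace ℝ (Fin 3)) 2 := by
    rw [coe_neg_sphere]; simp
  rw [hnormW] at h
  refine ⟨?_, ?_, ?_⟩
  · have := congrArg (fun z : EuclideanSpace ℝ (Fin 3) => z 0) h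
    simp only [PiLp.add_apply, PiLp.smul_apply, smul_eq_mul] at this
    rw [this, hneg0, LinearIsometry.coe_mk, hL0]; ring
  · have := congrArg (fun z : EuclideanSpace ℝ (Fin 3) => z 1) h
    simp only [PiLp.add_apply, PiLp.smul_apply, smul_eq_mul] at this
    rw [this, hneg1, LinearIsometry.coe_mk, hL1]; ring
  · have := congrArg (fun z : EuclideanSpace ℝ (Fin 3) => z 2) h
    simp only [PiLp.add_apply, PiLp.smul_apply, smul_eq_mul] at this
    rw [this, hneg2, hW2]; ring

/-- **Height along the torus-side product chart**: `v₂ · f₂ (ιT (θ, w)) = 1 / (1 + 2‖w‖²)`.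
[cite: BaykurKamada2015, §2] -/
theorem helper_degree_base_level (hT : IsTorusSideProduct f v ιT)
    (hv0 : (v : EuclideanSpace ℝ (Fin 3)) 0 = 0) (hv1 : (v : EuclideanSpace ℝ (Fin 3)) 1 = 0)
    (θ : Fb) (w : EuclideanSpace ℝ (Fin 2)) :
    (v : EuclideanSpace ℝ (Fin 3)) 2 *
        ((f (ιT (θ, w)) : Metric.sphere (0 : EuclideanSpace ℝ (Fin 3)) 1) : EuclideanSpace ℝ (Fin 3)) 2 =
      1 / (1 + 2 * ‖w‖ ^ 2) := by
  have hv2 : (v : EuclideanSpace ℝ (Fin 3)) 2 ^ 2 = 1 := by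
    have hn := norm_eq_of_mem_sphere v
    have : ‖(v : EuclideanSpace ℝ (Fin 3))‖ ^ 2 = 1 := by rw [hn]; norm_num
    rw [EuclideanSpace.norm_eq, Real.sq_sqrt (Finset.sum_nonneg fun i _ => by positivity),
      Fin.sum_univ_three] at this
    simpa [hv0, hv1] using this
  rw [hT.formula]
  obtain ⟨O, hO⟩ := helper_degree_stereo_symm_coord (v := v) hv0 hv1
  obtain ⟨-, -, h2⟩ := hO (OpenPartialHomeomorph.univBall (0 : EuclideanSpace ℝ (Fin 2)) 2 w)
  rw [h2, helper_degree_norm_univBall_two_sq]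
  have h1 : 0 < 1 + ‖w‖ ^ 2 := by positivity
  have h3 : 0 < 1 + 2 * ‖w‖ ^ 2 := by positivity
  rw [show (v : EuclideanSpace ℝ (Fin 3)) 2 * ((4 * ‖w‖ ^ 2 / (1 + ‖w‖ ^ 2) + 4)⁻¹ *
      (4 - 4 * ‖w‖ ^ 2 / (1 + ‖w‖ ^ 2)) * (v : EuclideanSpace ℝ (Fin 3)) 2) =
      (v : EuclideanSpace ℝ (Fin 3)) 2 ^ 2 * (((4 * ‖w‖ ^ 2 / (1 + ‖w‖ ^ 2) + 4)⁻¹ *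
      (4 - 4 * ‖w‖ ^ 2 / (1 + ‖w‖ ^ 2)))) by ring, hv2, one_mul]
  field_simp
  ring

end Side

/-- **A linear isometry of the plane is a rotation or a reflection**: it carries the unit-speed
parametrisation `circlePt` to `t ↦ circlePt (s₀ t + α)` with `s₀ = ±1` (its determinant).
(Mathlib's `linear_isometry_complex`, transported along `ℝ² ≅ ℂ`.) [folklore] -/
theorem helper_degree_isometry_circlePt
    (O : EuclideanSpace ℝ (Fin 2) →ₗᵢ[ℝ] EuclideanSpace ℝ (Fin 2)) :
    ∃ s₀ α : ℝ, (s₀ = 1 ∨ s₀ = -1) ∧ ∀ t : ℝ,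
      O ((circlePt t : Metric.sphere (0 : EuclideanSpace ℝ (Fin 2)) 1) : EuclideanSpace ℝ (Fin 2)) =
        ((circlePt (s₀ * t + α) : Metric.sphere (0 : EuclideanSpace ℝ (Fin 2)) 1) :
          EuclideanSpace ℝ (Fin 2)) := by
  set Oe : EuclideanSpace ℝ (Fin 2) ≃ₗᵢ[ℝ] EuclideanSpace ℝ (Fin 2) :=
    O.toLinearIsometryEquiv rfl with hOe
  have hOe_apply : ∀ u, Oe u = O u := fun u => rfl
  set repr : ℂ ≃ₗᵢ[ℝ] EuclideanSpace ℝ (Fin 2) := Complex.orthonormalBasisOneI.repr with hrepr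
  have htoC : ∀ u : EuclideanSpace ℝ (Fin 2), toC u = repr.symm u := fun u =>
    toC_eq_orthonormalBasisOneI_repr_symm u
  set Oc : ℂ ≃ₗᵢ[ℝ] ℂ := (repr.trans Oe).trans repr.symm with hOc
  have hOc : ∀ u : EuclideanSpace ℝ (Fin 2), toC (O u) = Oc (toC u) := fun u => by
    rw [htoC, htoC, hOc, LinearIsometryEquiv.trans_apply, LinearIsometryEquiv.trans_apply,
      LinearIsometryEquiv.apply_symm_apply, hOe_apply]
  obtain ⟨a, ha⟩ := linear_isometry_complex Oc
  set θ₀ : ℝ := Complex.arg (a : ℂ) with hθ₀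
  have haexp : a = Circle.exp θ₀ := (Circle.exp_arg a).symm
  have h2π : (2 * Real.pi : ℝ) ≠ 0 := by positivity
  rcases ha with ha | ha
  · refine ⟨1, θ₀ / (2 * Real.pi), Or.inl rfl, fun t => ?_⟩
    apply toC_injective
    rw [hOc, ha, rotation_apply, toC_circlePt, toC_circlePt, haexp, ← Circle.coe_mul,
      ← Circle.exp_add]
    congr 2
    field_simp
    ring
  · refine ⟨-1, θ₀ / (2 * Real.pi), Or.inr rfl, fun t => ?_⟩
    apply toC_injective
    rw [hOc, ha, LinearIsometryEquiv.trans_apply, Complex.conjLIE_apply, rotation_apply,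
      toC_circlePt, toC_circlePt, haexp, ← Circle.coe_inv_eq_conj, ← Circle.exp_neg,
      ← Circle.coe_mul, ← Circle.exp_add]
    congr 2
    field_simp
    ring

section Side

variable {X : Type} [TopologicalSpace X] [ChartedSpace (EuclideanSpace ℝ (Fin 4)) X]
  {Fb : Type} [TopologicalSpace Fb] [ChartedSpace (EuclideanSpace ℝ (Fin 2)) Fb]
  {f : X → Metric.sphere (0 : EuclideanSpace ℝ (Fin 3)) 1}
  {v : Metric.sphere (0 : EuclideanSpace ℝ (Fin 3)) 1}
  {ιT : Fb × EuclideanSpace ℝ (Fin 2) → X}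

/-- **Planar part along the torus-side product chart**: there is a linear isometry `O` of `ℝ²`
with `(f₀, f₁) (ιT (θ, w)) = (2 √(1 + ‖w‖²) / (1 + 2 ‖w‖²)) · O w`.
[cite: BaykurKamada2015, §2] -/
theorem helper_degree_base_planar (hT : IsTorusSideProduct f v ιT)
    (hv0 : (v : EuclideanSpace ℝ (Fin 3)) 0 = 0) (hv1 : (v : EuclideanSpace ℝ (Fin 3)) 1 = 0) :
    ∃ O : EuclideanSpace ℝ (Fin 2) →ₗᵢ[ℝ] EuclideanSpace ℝ (Fin 2), ∀ (θ : Fb) (w : EuclideanSpace ℝ (Fin 2)),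
      ((f (ιT (θ, w)) : Metric.sphere (0 : EuclideanSpace ℝ (Fin 3)) 1) : EuclideanSpace ℝ (Fin 3)) 0 =
          2 * √(1 + ‖w‖ ^ 2) / (1 + 2 * ‖w‖ ^ 2) * (O w) 0 ∧
      ((f (ιT (θ, w)) : Metric.sphere (0 : EuclideanSpace ℝ (Fin 3)) 1) : EuclideanSpace ℝ (Fin 3)) 1 =
          2 * √(1 + ‖w‖ ^ 2) / (1 + 2 * ‖w‖ ^ 2) * (O w) 1 := by
  obtain ⟨O, hO⟩ := helper_degree_stereo_symm_coord (v := v) hv0 hv1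
  refine ⟨O, fun θ w => ?_⟩
  rw [hT.formula]
  obtain ⟨h0, h1, -⟩ := hO (OpenPartialHomeomorph.univBall (0 : EuclideanSpace ℝ (Fin 2)) 2 w)
  have hsq : 0 < 1 + ‖w‖ ^ 2 := by positivity
  have hs : 0 < √(1 + ‖w‖ ^ 2) := Real.sqrt_pos.2 hsq
  have h3 : 0 < 1 + 2 * ‖w‖ ^ 2 := by positivity
  have hOw : ∀ i, O (OpenPartialHomeomorph.univBall (0 : EuclideanSpace ℝ (Fin 2)) 2 w) i =
      (2 : ℝ) * (√(1 + ‖w‖ ^ 2))⁻¹ * O w i := fun i => by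
    rw [helper_degree_univBall_two_apply, O.map_smul, PiLp.smul_apply, smul_eq_mul]
  have hcoef : (4 * ‖w‖ ^ 2 / (1 + ‖w‖ ^ 2) + 4)⁻¹ * 4 * (2 * (√(1 + ‖w‖ ^ 2))⁻¹) =
      2 * √(1 + ‖w‖ ^ 2) / (1 + 2 * ‖w‖ ^ 2) := by
    have hss : √(1 + ‖w‖ ^ 2) * √(1 + ‖w‖ ^ 2) = 1 + ‖w‖ ^ 2 := Real.mul_self_sqrt hsq.le
    field_simp
    nlinarith [hss]
  constructor
  · rw [h0, helper_degree_norm_univBall_two_sq, hOw, ← hcoef]; ring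
  · rw [h1, helper_degree_norm_univBall_two_sq, hOw, ← hcoef]; ring

end Side

/-- **Base geometry of the torus-side product chart** (registered layer B of the degree lemma
`helper_sliceGluing_vanishingDegree`): along the base circle `t ↦ ιT (θ, R · circlePt t)` the
height `v₂ f₂` is the constant `1 / (1 + 2R²)` and the planar part of `f` is the positive multiple
`2R√(1 + R²) / (1 + 2R²)` of `circlePt (s₀ t + α)`, with a sign `s₀ = ±1` and a phase `α`
depending only on the chart (the longitude loop has degree `±1`). [cite: BaykurKamada2015, §2] -/
theorem helper_degree_base : ∀ (X : Type) [TopologicalSpace X] [ChartedSpace (EuclideanSpace ℝ (Fin 4)) X] (f : X → Metric.sphere (0 : EuclideanSpace ℝ (Fin 3)) 1) (v : Metric.sphere (0 : EuclideanSpace ℝ (Fin 3)) 1), (v : EuclideanSpace ℝ (Fin 3)) 0 = 0 → (v : EuclideanSpace ℝ (Fin 3)) 1 = 0 → ∀ (Fb : Type) [TopologicalSpace Fb] [ChartedSpace (EuclideanSpace ℝ (Fin 2)) Fb] (ιT : Fb × EuclideanSpace ℝ (Fin 2) → X), IsTorusSideProduct f v ιT → ∃ (s₀ α : ℝ), (s₀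 = 1 ∨ s₀ = -1) ∧ ∀ (θ : Fb) (R t : ℝ), 0 ≤ R → (v : EuclideanSpace ℝ (Fin 3)) 2 * ((f (ιT (θ, R • ((circlePt t : Metric.sphere (0 : EuclideanSpace ℝ (Fin 2)) 1) : EuclideanSpace ℝ (Fin 2)))) : Metric.sphere (0 : EuclideanSpace ℝ (Fin 3)) 1) : EuclideanSpace ℝ (Fin 3)) 2 = 1 / (1 + 2 * R ^ 2) ∧ ((f (ιT (θ, R • ((circlePt t : Metric.sphere (0 : EuclideanSpace ℝ (Fin 2)) 1) : EuclideanSpace ℝ (Fin 2)))) : Metric.sphere (0 : EuclideanSpace ℝ (Fin 3)) 1) : EuclideanSpace ℝ (Fin 3)) 0 = 2 * R * √(1 + R ^ 2) / (1 + 2 * R ^ 2) * ((circlePt (s₀ * t + α) : Metric.sphere (0 : EuclideanSpace ℝ (Fin 2)) 1) : EuclideanSpace ℝ (Fin 2)) 0 ∧ ((f (ιT (θ, R • ((circlePt t : Metric.sphere (0 : EuclideanSpace ℝ (Fin 2)) 1) : EuclideanSpace ℝ (Fin 2)))) : Metric.sphere (0 : EuclideanSpace ℝ (Fin 3)) 1)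 : EuclideanSpace ℝ (Fin 3)) 1 = 2 * R * √(1 + R ^ 2) / (1 + 2 * R ^ 2) * ((circlePt (s₀ * t + α) : Metric.sphere (0 : EuclideanSpace ℝ (Fin 2)) 1) : EuclideanSpace ℝ (Fin 2)) 1 := by
  intro X _ _ f v hv0 hv1 Fb _ _ ιT hT
  obtain ⟨O, hO⟩ := helper_degree_base_planar hT hv0 hv1
  obtain ⟨s₀, α, hs₀, hOc⟩ := helper_degree_isometry_circlePt O
  refine ⟨s₀, α, hs₀, fun θ R t hR => ?_⟩
  have hnorm : ‖R • ((circlePt t : Metric.sphere (0 : EuclideanSpace ℝ (Fin 2)) 1) :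
      EuclideanSpace ℝ (Fin 2))‖ = R := by
    rw [norm_smul, Real.norm_eq_abs, abs_of_nonneg hR, norm_eq_of_mem_sphere, mul_one]
  refine ⟨?_, ?_, ?_⟩
  · rw [helper_degree_base_level hT hv0 hv1, hnorm]
  · rw [(hO θ _).1, hnorm, O.map_smul, hOc, PiLp.smul_apply, smul_eq_mul]; ring
  · rw [(hO θ _).2, hnorm, O.map_smul, hOc, PiLp.smul_apply, smul_eq_mul]; ring

end Summit.SmoothPoincare4.SmoothPoincare4.Cruxes.RungOne.Sketch

end
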